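import Summits.QuantumFields.YangMills.Theorems.ColdStartUniversalityLatticeLangevinMartingaleCLTStep
import HarnessLib

/-!
# Route `ColdStartUniversality` (fixed-cut-off SZZ dynamics, sampler package): the MARTINGALE CENTRAL LIMIT MECHANISM, part 3 —
# from the telescoping estimate to characteristic functions, and Lévy's theorem (convergence in distribution to `N(0, σ²)`)

Helper file (seat `ym-line-csu-p1`, g35; `--supports stmt-QuantumFields-24809`).  Generic probability, no SZZ object.  Consequences of the
telescoping estimate of part 2 (`norm_integral_cexp_sum_sub_one_le`):
* ★★ `norm_integral_cexp_sum_sub_gaussian_le` — under the same hypotheses, for every `σ² ≥ 0` and real `θ`,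
  `‖E[e^(iθS_n)] − e^(−θ²σ²/2)‖ ≤ n e^(nθ²δ/2) ρ(θ) + (θ²/2) e^(max(nθ²δ/2, θ²σ²/2)) · E|V_n − σ²|`
  (so `E e^(iθ S_n) → e^(−θ²σ²/2)` as soon as `nρ → 0` and the predictable variance `V_n → σ²` in `L¹` — in the applications by the ergodic
  theorem for the sampler);
* `norm_integral_cexp_sub_integral_cexp_le` — `‖E e^(iθX) − E e^(iθY)‖ ≤ |θ| ε` when `|X − Y| ≤ ε` (boundary terms of the corrector);
* ★★ `tendstoInDistribution_of_tendsto_charFun_gaussian` — if `E e^(iθ X_N) → e^(−θ²σ²/2)` for every real `θ` then `X_N → Y` in distribution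
  for every `Y` of law `gaussianReal 0 σ²` (Mathlib's `TendstoInDistribution`, Lévy's convergence theorem
  `ProbabilityMeasure.tendsto_iff_tendsto_charFun`, `charFun_gaussianReal`).
THEOREMS ONLY, no definition, no sorry; [folklore].  HONEST FRAMING: plumbing for fixed-cut-off sampler statements; `UniformColdStartMixing` (24809) is NOT restated; no crux, rung or summit
statement is proved; the Yang–Mills mass gap is NOT proved.
-/

set_option autoImplicit false

noncomputable section

namespace Summit.QuantumFields.YangMills.Theorems.ColdStartUniversality

open MeasureTheory ProbabilityTheory Filter Topology Finset
open scoped NNReal ENNReal BigOperators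

/-! ## §5. From the telescoping estimate to the characteristic function -/

/-- ★★ **Characteristic function within reach of the Gaussian.**  Under the hypotheses of `norm_integral_cexp_sum_sub_one_le`, for every
`σ² ≥ 0` and real `θ`:
`‖E[e^(iθS_n)] − e^(−θ²σ²/2)‖ ≤ n e^(nθ²δ/2) ρ(θ) + (θ²/2) e^(max(nθ²δ/2, θ²σ²/2)) · E|V_n − σ²|`.
(So `E e^(iθ S_n) → e^(−θ²σ²/2)` as soon as `nρ → 0` and `V_n → σ²` in `L¹`.) [folklore] -/
theorem norm_integral_cexp_sum_sub_gaussian_le {Ω : Type*} {mΩ : MeasurableSpace Ω} {P : Measure Ω} [IsProbabilityMeasure P]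
    (ℱ : ℕ → MeasurableSpace Ω) (hℱ : ∀ k, ℱ k ≤ mΩ)
    (D v : ℕ → Ω → ℝ) (hDm : ∀ k, Measurable (D k)) (hvm : ∀ k, Measurable (v k))
    {B δ η : ℝ} (hB : 0 ≤ B) (hδ : 0 ≤ δ) (hη : 0 ≤ η)
    (hDb : ∀ k ω, |D k ω| ≤ B) (hv0 : ∀ k ω, 0 ≤ v k ω) (hvb : ∀ k ω, v k ω ≤ δ)
    (hSF : ∀ k, Measurable[ℱ k] fun ω => ∑ j ∈ Finset.range k, D j ω)
    (hVF : ∀ k, Measurable[ℱ k] fun ω => ∑ j ∈ Finset.range k, v j ω)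
    (n : ℕ)
    (horth : ∀ k < n, ∀ Z : Ω → ℝ, Measurable[ℱ k] Z → (∀ ω, 0 ≤ Z ω) → (∃ C : ℝ, ∀ ω, Z ω ≤ C) →
      ∫ ω, Z ω * D k ω ∂P = 0)
    (hvar : ∀ k < n, ∀ Z : Ω → ℝ, Measurable[ℱ k] Z → (∀ ω, 0 ≤ Z ω) → (∃ C : ℝ, ∀ ω, Z ω ≤ C) →
      |∫ ω, Z ω * (D k ω ^ 2 - v k ω) ∂P| ≤ η * ∫ ω, Z ω ∂P)
    {σ2 : ℝ} (hσ : 0 ≤ σ2) (θ : ℝ) :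
    ‖(∫ ω, Complex.exp (((θ * ∑ j ∈ Finset.range n, D j ω : ℝ) : ℂ) * Complex.I) ∂P) -
        Complex.exp (-((θ ^ 2 * σ2 / 2 : ℝ) : ℂ))‖ ≤
      n * Real.exp (n * (θ ^ 2 * δ / 2)) * (θ ^ 2 * η + |θ| ^ 3 * Real.exp (|θ| * B) * B * (δ + η) +
        (θ ^ 2 * δ / 2) ^ 2 + (|θ| * B + θ ^ 2 * B ^ 2 / 2) * (θ ^ 2 * δ / 2)) +
      θ ^ 2 / 2 * Real.exp (max (n * (θ ^ 2 * δ / 2)) (θ ^ 2 * σ2 / 2)) *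
        ∫ ω, |(∑ j ∈ Finset.range n, v j ω) - σ2| ∂P := by
  have hmain := norm_integral_cexp_sum_sub_one_le ℱ hℱ D v hDm hvm hB hδ hη hDb hv0 hvb hSF hVF n horth hvar θ
  -- `|e^x − e^y| ≤ e^(max x y)|x − y|` (from `e^t − 1 ≤ t e^t`)
  have hexpL : ∀ x y : ℝ, |Real.exp x - Real.exp y| ≤ Real.exp (max x y) * |x - y| := by
    have key : ∀ x y : ℝ, y ≤ x → |Real.exp x - Real.exp y| ≤ Real.exp (max x y) * |x - y| := fun x y hxy => by
      rw [max_eq_left hxy, abs_of_nonneg (by linarith [Real.exp_le_exp.2 hxy]), abs_of_nonneg (by linarith)]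
      have h1 : Real.exp (x - y) - 1 ≤ (x - y) * Real.exp (x - y) := by
        have h3 := Real.add_one_le_exp (-(x - y))
        have h4 : Real.exp (-(x - y)) * Real.exp (x - y) = 1 := by rw [← Real.exp_add, neg_add_cancel, Real.exp_zero]
        nlinarith [Real.exp_pos (x - y), Real.exp_pos (-(x - y))]
      have h2 : Real.exp x = Real.exp y * Real.exp (x - y) := by rw [← Real.exp_add]; ring_nf
      rw [h2]
      nlinarith [Real.exp_pos y, Real.exp_pos (x - y)]
    intro x y
    rcases le_total y x with hxy | hxy
    · exact key x y hxy
    · have h := key y x hxy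
      rwa [abs_sub_comm, max_comm, abs_sub_comm (a := y)] at h
  set A : ℝ := θ ^ 2 * δ / 2 with hA
  set ρ : ℝ := θ ^ 2 * η + |θ| ^ 3 * Real.exp (|θ| * B) * B * (δ + η) + (θ ^ 2 * δ / 2) ^ 2 +
    (|θ| * B + θ ^ 2 * B ^ 2 / 2) * (θ ^ 2 * δ / 2) with hρ
  set c : ℝ := θ ^ 2 * σ2 / 2 with hc
  set S : Ω → ℝ := fun ω => ∑ j ∈ Finset.range n, D j ω with hS
  set V : Ω → ℝ := fun ω => ∑ j ∈ Finset.range n, v j ω with hV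
  set g : Ω → ℝ := fun ω => θ ^ 2 / 2 * V ω with hg
  have hSm : Measurable S := (hSF n).mono (hℱ n) le_rfl
  have hVm : Measurable V := (hVF n).mono (hℱ n) le_rfl
  have hgm : Measurable g := hVm.const_mul _
  have hVb : ∀ ω, V ω ≤ n * δ := fun ω =>
    (Finset.sum_le_sum fun j _ => hvb j ω).trans (by rw [Finset.sum_const, Finset.card_range, nsmul_eq_mul])
  have hV0 : ∀ ω, 0 ≤ V ω := fun ω => Finset.sum_nonneg fun j _ => hv0 j ω
  have hg0 : ∀ ω, 0 ≤ g ω := fun ω => mul_nonneg (by positivity) (hV0 ω)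
  have hgA : ∀ ω, g ω ≤ n * A := fun ω => by
    simp only [hg, hA]; have := hVb ω; nlinarith [sq_nonneg θ]
  set e : Ω → ℂ := fun ω => Complex.exp (((θ * S ω : ℝ) : ℂ) * Complex.I) with he
  have hem : Measurable e := ((Complex.measurable_ofReal.comp (hSm.const_mul θ)).mul_const _).cexp
  have hen : ∀ ω, ‖e ω‖ = 1 := fun ω => by simp only [he]; exact Complex.norm_exp_ofReal_mul_I _
  -- `W_n = e · exp(g)` pointwise
  have hW : ∀ ω, Complex.exp (((θ * S ω : ℝ) : ℂ) * Complex.I + ((θ ^ 2 / 2 * V ω : ℝ) : ℂ)) =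
      e ω * ((Real.exp (g ω) : ℝ) : ℂ) := fun ω => by
    simp only [he, hg]; rw [Complex.exp_add, Complex.ofReal_exp]
  -- integrability
  have hIntC : ∀ {f : Ω → ℂ} {Cf : ℝ}, Measurable f → (∀ ω, ‖f ω‖ ≤ Cf) → Integrable f P :=
    fun {f Cf} hf hfb => (integrable_const Cf).mono' hf.aestronglyMeasurable (Eventually.of_forall hfb)
  have ie : Integrable e P := hIntC hem fun ω => (hen ω).le
  have hdiffm : Measurable fun ω => e ω * (((Real.exp c - Real.exp (g ω) : ℝ)) : ℂ) :=
    hem.mul (Complex.measurable_ofReal.comp (measurable_const.sub hgm.exp))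
  have hdiffb : ∀ ω, ‖e ω * (((Real.exp c - Real.exp (g ω) : ℝ)) : ℂ)‖ ≤ Real.exp c + Real.exp (n * A) := fun ω => by
    rw [norm_mul, hen, one_mul, Complex.norm_real, Real.norm_eq_abs]
    exact (abs_sub _ _).trans (by
      rw [abs_of_pos (Real.exp_pos _), abs_of_pos (Real.exp_pos _)]
      exact add_le_add le_rfl (Real.exp_le_exp.2 (hgA ω)))
  have idiff : Integrable (fun ω => e ω * (((Real.exp c - Real.exp (g ω) : ℝ)) : ℂ)) P := hIntC hdiffm hdiffb
  have iW : Integrable (fun ω => e ω * ((Real.exp (g ω) : ℝ) : ℂ)) P :=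
    hIntC (hem.mul (Complex.measurable_ofReal.comp hgm.exp)) fun ω => by
      rw [norm_mul, hen, one_mul, Complex.norm_real, Real.norm_eq_abs, abs_of_pos (Real.exp_pos _)]
      exact Real.exp_le_exp.2 (hgA ω)
  -- the algebraic rearrangement
  have hkey : (∫ ω, e ω ∂P) - Complex.exp (-(c : ℂ)) =
      Complex.exp (-(c : ℂ)) * ((∫ ω, e ω * (((Real.exp c - Real.exp (g ω) : ℝ)) : ℂ) ∂P) +
        ((∫ ω, e ω * ((Real.exp (g ω) : ℝ) : ℂ) ∂P) - 1)) := by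
    have hsplit : ∀ ω, e ω * ((Real.exp c : ℝ) : ℂ) = e ω * (((Real.exp c - Real.exp (g ω) : ℝ)) : ℂ) +
        e ω * ((Real.exp (g ω) : ℝ) : ℂ) := fun ω => by push_cast; ring
    have h1 : (∫ ω, e ω * (((Real.exp c - Real.exp (g ω) : ℝ)) : ℂ) ∂P) + ∫ ω, e ω * ((Real.exp (g ω) : ℝ) : ℂ) ∂P =
        (∫ ω, e ω ∂P) * ((Real.exp c : ℝ) : ℂ) := by
      rw [← integral_add idiff iW, ← integral_mul_const]
      exact integral_congr_ae (ae_of_all _ fun ω => (hsplit ω).symm)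
    have hcc : Complex.exp (-(c : ℂ)) * ((Real.exp c : ℝ) : ℂ) = 1 := by
      rw [Complex.ofReal_exp, ← Complex.exp_add, neg_add_cancel, Complex.exp_zero]
    calc (∫ ω, e ω ∂P) - Complex.exp (-(c : ℂ))
        = Complex.exp (-(c : ℂ)) * ((∫ ω, e ω ∂P) * ((Real.exp c : ℝ) : ℂ) - 1) := by
          linear_combination (-(∫ ω, e ω ∂P)) * hcc
      _ = Complex.exp (-(c : ℂ)) * ((∫ ω, e ω * (((Real.exp c - Real.exp (g ω) : ℝ)) : ℂ) ∂P) +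
          ((∫ ω, e ω * ((Real.exp (g ω) : ℝ) : ℂ) ∂P) - 1)) := by rw [← h1]; ring
  have hnc : ‖Complex.exp (-(c : ℂ))‖ ≤ 1 := by
    rw [← Complex.ofReal_neg, ← Complex.ofReal_exp, Complex.norm_real, Real.norm_eq_abs, abs_of_pos (Real.exp_pos _),
      Real.exp_le_one_iff]
    simp only [hc]; exact neg_nonpos.2 (by positivity)
  -- the two pieces
  have hmain' : ‖(∫ ω, e ω * ((Real.exp (g ω) : ℝ) : ℂ) ∂P) - 1‖ ≤ n * Real.exp (n * A) * ρ := by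
    have h2 : (fun ω => e ω * ((Real.exp (g ω) : ℝ) : ℂ)) =
        fun ω => Complex.exp (((θ * S ω : ℝ) : ℂ) * Complex.I + ((θ ^ 2 / 2 * V ω : ℝ) : ℂ)) := funext fun ω => (hW ω).symm
    rw [h2]
    exact hmain
  have hdiffI : ‖∫ ω, e ω * (((Real.exp c - Real.exp (g ω) : ℝ)) : ℂ) ∂P‖ ≤
      θ ^ 2 / 2 * Real.exp (max (n * A) c) * ∫ ω, |V ω - σ2| ∂P := by
    have iabs : Integrable (fun ω => |V ω - σ2|) P :=
      (integrable_const (n * δ + |σ2|)).mono' (hVm.sub measurable_const).abs.aestronglyMeasurable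
        (Eventually.of_forall fun ω => by
          rw [Real.norm_eq_abs, abs_abs]
          exact (abs_sub _ _).trans (add_le_add (by rw [abs_of_nonneg (hV0 ω)]; exact hVb ω) le_rfl))
    calc ‖∫ ω, e ω * (((Real.exp c - Real.exp (g ω) : ℝ)) : ℂ) ∂P‖
        ≤ ∫ ω, ‖e ω * (((Real.exp c - Real.exp (g ω) : ℝ)) : ℂ)‖ ∂P := norm_integral_le_integral_norm _
      _ ≤ ∫ ω, θ ^ 2 / 2 * Real.exp (max (n * A) c) * |V ω - σ2| ∂P := by
          refine integral_mono idiff.norm (iabs.const_mul _) fun ω => ?_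
          rw [norm_mul, hen, one_mul, Complex.norm_real, Real.norm_eq_abs]
          calc |Real.exp c - Real.exp (g ω)| ≤ Real.exp (max c (g ω)) * |c - g ω| := hexpL _ _
            _ ≤ Real.exp (max (n * A) c) * (θ ^ 2 / 2 * |V ω - σ2|) := by
                refine mul_le_mul (Real.exp_le_exp.2 (max_le (le_max_right _ _) ((hgA ω).trans (le_max_left _ _)))) ?_
                  (abs_nonneg _) (Real.exp_pos _).le
                simp only [hc, hg]
                rw [show θ ^ 2 * σ2 / 2 - θ ^ 2 / 2 * V ω = (θ ^ 2 / 2) * (σ2 - V ω) by ring, abs_mul,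
                  abs_of_nonneg (by positivity : (0 : ℝ) ≤ θ ^ 2 / 2), abs_sub_comm]
            _ = θ ^ 2 / 2 * Real.exp (max (n * A) c) * |V ω - σ2| := by ring
      _ = θ ^ 2 / 2 * Real.exp (max (n * A) c) * ∫ ω, |V ω - σ2| ∂P := integral_const_mul _ _
  rw [hkey]
  calc ‖Complex.exp (-(c : ℂ)) * ((∫ ω, e ω * (((Real.exp c - Real.exp (g ω) : ℝ)) : ℂ) ∂P) +
        ((∫ ω, e ω * ((Real.exp (g ω) : ℝ) : ℂ) ∂P) - 1))‖
      ≤ 1 * (‖∫ ω, e ω * (((Real.exp c - Real.exp (g ω) : ℝ)) : ℂ) ∂P‖ + ‖(∫ ω, e ω * ((Real.exp (g ω) : ℝ) : ℂ) ∂P) - 1‖) := by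
        rw [norm_mul]; exact mul_le_mul hnc (norm_add_le _ _) (norm_nonneg _) zero_le_one
    _ ≤ 1 * (θ ^ 2 / 2 * Real.exp (max (n * A) c) * (∫ ω, |V ω - σ2| ∂P) + n * Real.exp (n * A) * ρ) := by
        gcongr
    _ = n * Real.exp (n * A) * ρ + θ ^ 2 / 2 * Real.exp (max (n * A) c) * ∫ ω, |V ω - σ2| ∂P := by ring

/-- Perturbation of characteristic functions: `‖E e^(iθX) − E e^(iθY)‖ ≤ |θ|·ε` when `|X − Y| ≤ ε` pointwise. [folklore] -/
theorem norm_integral_cexp_sub_integral_cexp_le {Ω : Type*} {mΩ : MeasurableSpace Ω} {P : Measure Ω} [IsProbabilityMeasure P]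
    {X Y : Ω → ℝ} (hX : Measurable X) (hY : Measurable Y) {ε : ℝ} (hε : ∀ ω, |X ω - Y ω| ≤ ε) (θ : ℝ) :
    ‖(∫ ω, Complex.exp (((θ * X ω : ℝ) : ℂ) * Complex.I) ∂P) - ∫ ω, Complex.exp (((θ * Y ω : ℝ) : ℂ) * Complex.I) ∂P‖ ≤
      |θ| * ε := by
  have hIntC : ∀ {f : Ω → ℂ} {Cf : ℝ}, Measurable f → (∀ ω, ‖f ω‖ ≤ Cf) → Integrable f P :=
    fun {f Cf} hf hfb => (integrable_const Cf).mono' hf.aestronglyMeasurable (Eventually.of_forall hfb)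
  have iX : Integrable (fun ω => Complex.exp (((θ * X ω : ℝ) : ℂ) * Complex.I)) P :=
    hIntC ((Complex.measurable_ofReal.comp (hX.const_mul θ)).mul_const _).cexp fun ω => (Complex.norm_exp_ofReal_mul_I _).le
  have iY : Integrable (fun ω => Complex.exp (((θ * Y ω : ℝ) : ℂ) * Complex.I)) P :=
    hIntC ((Complex.measurable_ofReal.comp (hY.const_mul θ)).mul_const _).cexp fun ω => (Complex.norm_exp_ofReal_mul_I _).le
  rw [← integral_sub iX iY]
  calc ‖∫ ω, (Complex.exp (((θ * X ω : ℝ) : ℂ) * Complex.I) - Complex.exp (((θ * Y ω : ℝ) : ℂ) * Complex.I)) ∂P‖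
      ≤ ∫ ω, ‖Complex.exp (((θ * X ω : ℝ) : ℂ) * Complex.I) - Complex.exp (((θ * Y ω : ℝ) : ℂ) * Complex.I)‖ ∂P :=
        norm_integral_le_integral_norm _
    _ ≤ ∫ ω, |θ| * ε ∂P := by
        refine integral_mono (iX.sub iY).norm (integrable_const _) fun ω => ?_
        calc ‖Complex.exp (((θ * X ω : ℝ) : ℂ) * Complex.I) - Complex.exp (((θ * Y ω : ℝ) : ℂ) * Complex.I)‖
            ≤ |θ * X ω - θ * Y ω| := norm_cexp_mul_I_sub_cexp_mul_I_le _ _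
          _ = |θ| * |X ω - Y ω| := by rw [← mul_sub, abs_mul]
          _ ≤ |θ| * ε := mul_le_mul_of_nonneg_left (hε ω) (abs_nonneg θ)
    _ = |θ| * ε := by simp

/-! ## §6. Lévy: pointwise convergence of characteristic functions to the Gaussian one -/

/-- ★★ **Convergence in distribution to `N(0, σ²)` from characteristic functions.**  If `X_N` are real random variables on a probability
space with `E exp(iθ X_N) → exp(−θ²σ²/2)` for every real `θ` (`σ² ≥ 0`), then `X_N → Y` in distribution for every `Y` with law
`gaussianReal 0 σ²` (Mathlib's Lévy convergence theorem `ProbabilityMeasure.tendsto_iff_tendsto_charFun`). [folklore] -/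
theorem tendstoInDistribution_of_tendsto_charFun_gaussian {Ω : Type*} {mΩ : MeasurableSpace Ω} {P : Measure Ω}
    [IsProbabilityMeasure P] {X : ℕ → Ω → ℝ} (hX : ∀ N, Measurable (X N)) {σ2 : ℝ} (hσ : 0 ≤ σ2)
    (h : ∀ θ : ℝ, Tendsto (fun N => ∫ ω, Complex.exp (((θ * X N ω : ℝ) : ℂ) * Complex.I) ∂P) atTop
      (𝓝 (Complex.exp (-((θ ^ 2 * σ2 / 2 : ℝ) : ℂ)))))
    {Ω' : Type*} {mΩ' : MeasurableSpace Ω'} {P' : Measure Ω'} [IsProbabilityMeasure P'] {Y : Ω' → ℝ}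
    (hY : HasLaw Y (gaussianReal 0 σ2.toNNReal) P') :
    TendstoInDistribution X atTop Y (fun _ => P) P' where
  forall_aemeasurable N := (hX N).aemeasurable
  aemeasurable_limit := hY.aemeasurable
  tendsto := by
    refine ProbabilityMeasure.tendsto_iff_tendsto_charFun.2 fun t => ?_
    have hφ : Measurable fun x : ℝ => Complex.exp ((t : ℂ) * (x : ℂ) * Complex.I) :=
      ((measurable_const.mul Complex.measurable_ofReal).mul_const _).cexp
    have hN : ∀ N, charFun (P.map (X N)) t = ∫ ω, Complex.exp (((t * X N ω : ℝ) : ℂ) * Complex.I) ∂P := fun N => by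
      rw [charFun_apply_real, integral_map (hX N).aemeasurable hφ.aestronglyMeasurable]
      refine integral_congr_ae (ae_of_all _ fun ω => ?_)
      push_cast; ring_nf
    have hlim : charFun (P'.map Y) t = Complex.exp (-((t ^ 2 * σ2 / 2 : ℝ) : ℂ)) := by
      rw [hY.map_eq, charFun_gaussianReal, Real.coe_toNNReal _ hσ]
      congr 1
      push_cast
      ring
    simp only [ProbabilityMeasure.coe_mk]
    rw [hlim]
    simp_rw [hN]
    exact h t

end Summit.QuantumFields.YangMills.Theorems.ColdStartUniversality

end
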